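import Literature.Probability.LatticeModels.LeftmostInterfaceTightness
import Literature.Probability.RandomPlanarGeometry.SLEUniquenessInLaw
import HarnessLib

/-!
# Critical Ising interfaces and SLE₃: the leftmost interface, convergence modulo identification

Topic `Literature/Probability/LatticeModels` (family `crit-ising`). Leaf file of the spin half of
crit-ising.S17 (Chelkak–Duminil-Copin–Hongler–Kemppainen–Smirnov, *Convergence of Ising interfaces
to Schramm's SLE curves*, C. R. Math. Acad. Sci. Paris 352 (2014) 157–161, Theorem 1), written at
the review of the split of `convergesInLawToSLE_three_isingInterface_zd` (`InterfaceSLEProofs.lean`,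
§§3–4 of its module docstring: the corrected statement concerns the **leftmost** interface of
CDHKS §1, "We assume `γ^δ` to be the rightmost (or the leftmost) interface").

It joins the two lines of the tree that could not meet in `InterfaceSLEProofs.lean` (import
cycle: `LeftmostInterfaceTightness.lean` imports it):

* the **tightness of the laws of the leftmost interface** near `δ = 0`, PROVED modulo the FK-Ising
  RSW fact `fkIsing_rsw` (`LeftmostInterfaceTightness.exists_isTightMeasureSet_spinInterfaceLaw_leftmost`:
  Aizenman–Burchard's criterion with the traversal bound of the leftmost interface — sector
  argument, successive conditioning, band crossing bound; CDHKS §2, Thm. 3, Thm. 4, Rem. 4);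
* the assembly **tightness ∧ identification ∧ uniqueness ⟹ convergence** for the leftmost
  interface (`InterfaceSLEProofs.convergesInLawToSLE_leftmostInterface_of_tight_of_ident`, Prokhorov
  and the subsequence principle; CDHKS §3, last sentence), with uniqueness in law of chordal SLE
  now a theorem (`IsSLECurve.map_eq_holds`, `SLEUniquenessInLaw.lean`).

Results (all PROVED):

* `convergesInLawToSLE_leftmostInterface_of_fkIsing_rsw_of_ident` — `fkIsing_rsw` and the
  identification of the weak subsequential limits of the leftmost interface laws of ONE
  discretised Dobrushin domain as the SLE₃ law (hypothesis; CDHKS §3 = Chelkak–Smirnov 2012,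
  Thms 1.2, 5.6 + Kemppainen–Smirnov 2017, Thm. 1.5) give the convergence of its leftmost
  interfaces to SLE₃;
* `convergesInLawToSLE_leftmostInterface_of_fkIsing_rsw` — the same with the identification
  supplied by the named fact F2 `isSLELaw_three_of_subseqLimit_spinInterface` (all selection
  rules; specialised by `isSLELaw_three_of_subseqLimit_leftmostInterface`).

After the restatement of `convergesInLawToSLE_three_isingInterface_zd` to the leftmost interface
these read `fkIsing_rsw ∧ (identification) ⟹ zd`
(`convergesInLawToSLE_three_isingInterface_zd_of_fkIsing_rsw_of_ident`,
`convergesInLawToSLE_three_isingInterface_zd_of_fkIsing_rsw`). The named-fact frontier below the corrected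
CDHKS Theorem 1 along this line is `fkIsing_rsw` (`FKIsingRSW.lean`) and F2 (or its leftmost
specialisation, kept here as a hypothesis).

## References

* D. Chelkak, H. Duminil-Copin, C. Hongler, A. Kemppainen, S. Smirnov, C. R. Math. Acad. Sci.
  Paris 352 (2014) 157–161 (arXiv:1312.0533): §1, Thm. 1, §2 (Thm. 3, Thm. 4, Rem. 2, Rem. 4), §3.
  [CDHKSCRAS2014]
* D. Chelkak, S. Smirnov, Invent. Math. 189 (2012) 515–580, §2.2.1 (the leftmost route), Thms
  1.2, 5.6, Rem. 2.4. [ChelkakSmirnov2012Ising]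
* A. Kemppainen, S. Smirnov, Ann. Probab. 45 (2017) 698–779, Thm. 1.5, Rem. 2.10.
  [KemppainenSmirnov2017]
-/

noncomputable section

open MeasureTheory Filter Topology Set
open scoped NNReal ENNReal BoundedContinuousFunction

namespace Literature.Probability.LatticeModels

/-- **Convergence of the leftmost critical Ising interface to SLE₃, from `fkIsing_rsw` and the
identification of subsequential limits.** For a discretised Dobrushin domain `(D; a, b)`, `E`
(`IsDiscretisation D E`): if every weak subsequential limit, along meshes `u n → 0⁺`, of the laws
of the leftmost critical spin-Ising Dobrushin interfaces is the chordal SLE₃ law in `(D; a, b)`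
(CDHKS §3), then the leftmost interface converges in law to chordal SLE₃ as `δ → 0⁺` — the
tightness half being `exists_isTightMeasureSet_spinInterfaceLaw_leftmost` (CDHKS §2, from
`fkIsing_rsw`) and uniqueness of the SLE law `IsSLECurve.map_eq_holds`. PROVED.
[cite: CDHKSCRAS2014, Thm. 1, §2 Thm. 3 and §3] -/
theorem convergesInLawToSLE_leftmostInterface_of_fkIsing_rsw_of_ident (h₁ : fkIsing_rsw)
    {D : RandomPlanarGeometry.DobrushinDomain} {E : ℝ → DiscreteDobrushin} (hE : IsDiscretisation D E)
    (hident : ∀ (u : ℕ → ℝ), Tendsto u atTop (𝓝[>] 0) →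
      ∀ (ν : Measure (RandomPlanarGeometry.CurveClass ℂ)) [IsProbabilityMeasure ν],
        (∀ f : RandomPlanarGeometry.CurveClass ℂ →ᵇ ℝ,
          Tendsto (fun n => ∫ c, f c ∂spinInterfaceLaw D E (fun δ => leftmostInterface (E δ)) (u n))
            atTop (𝓝 (∫ c, f c ∂ν))) →
        RandomPlanarGeometry.IsSLELaw 3 D ν) :
    RandomPlanarGeometry.ConvergesInLawToSLE 3 D (Ωδ := fun _ => SpinConfig (Site 2))
      (fun δ σ => spinInterfaceCurve D δ (leftmostInterface (E δ) σ))
      (fun δ => isingZdDobrushinMeasure (E δ) criticalBetaTwo) :=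
  convergesInLawToSLE_leftmostInterface_of_tight_of_ident
    (exists_isTightMeasureSet_spinInterfaceLaw_leftmost h₁ hE) hident
    RandomPlanarGeometry.IsSLECurve.map_eq_holds

/-- **Convergence of the leftmost critical Ising interface to SLE₃, from `fkIsing_rsw` and F2.**
The identification hypothesis of `convergesInLawToSLE_leftmostInterface_of_fkIsing_rsw_of_ident`
supplied by the named fact `isSLELaw_three_of_subseqLimit_spinInterface` (CDHKS §3, stated for
all selection rules; specialised to the leftmost interface by
`isSLELaw_three_of_subseqLimit_leftmostInterface`). PROVED; named-fact frontier `fkIsing_rsw`, F2.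
[cite: CDHKSCRAS2014, Thm. 1 and §§2–3] -/
theorem convergesInLawToSLE_leftmostInterface_of_fkIsing_rsw (h₁ : fkIsing_rsw)
    (h₂ : isSLELaw_three_of_subseqLimit_spinInterface)
    {D : RandomPlanarGeometry.DobrushinDomain} {E : ℝ → DiscreteDobrushin} (hE : IsDiscretisation D E) :
    RandomPlanarGeometry.ConvergesInLawToSLE 3 D (Ωδ := fun _ => SpinConfig (Site 2))
      (fun δ σ => spinInterfaceCurve D δ (leftmostInterface (E δ) σ))
      (fun δ => isingZdDobrushinMeasure (E δ) criticalBetaTwo) :=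
  convergesInLawToSLE_leftmostInterface_of_fkIsing_rsw_of_ident h₁ hE
    fun _u hu ν _ hlim => isSLELaw_three_of_subseqLimit_leftmostInterface h₂ hE hu ν hlim

/-! ### In terms of the corrected statement of `InterfaceSLEProofs.lean` -/

/-- **CDHKS Theorem 1 (corrected transcription, leftmost interface) from `fkIsing_rsw` and the
identification of subsequential limits**: `convergesInLawToSLE_three_isingInterface_zd` follows
from the FK-Ising RSW fact (tightness half, CDHKS §2) and, for every discretised Dobrushin domain,
the identification of the weak subsequential limits of the leftmost interface laws as the SLE₃ law
(CDHKS §3, hypothesis). PROVED. [cite: CDHKSCRAS2014, Thm. 1 and §§2–3] -/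
theorem convergesInLawToSLE_three_isingInterface_zd_of_fkIsing_rsw_of_ident (h₁ : fkIsing_rsw)
    (hident : ∀ (D : RandomPlanarGeometry.DobrushinDomain) (E : ℝ → DiscreteDobrushin),
      IsDiscretisation D E → ∀ (u : ℕ → ℝ), Tendsto u atTop (𝓝[>] 0) →
      ∀ (ν : Measure (RandomPlanarGeometry.CurveClass ℂ)) [IsProbabilityMeasure ν],
        (∀ f : RandomPlanarGeometry.CurveClass ℂ →ᵇ ℝ,
          Tendsto (fun n => ∫ c, f c ∂spinInterfaceLaw D E (fun δ => leftmostInterface (E δ)) (u n))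
            atTop (𝓝 (∫ c, f c ∂ν))) →
        RandomPlanarGeometry.IsSLELaw 3 D ν) :
    convergesInLawToSLE_three_isingInterface_zd :=
  fun D E hE => convergesInLawToSLE_leftmostInterface_of_fkIsing_rsw_of_ident h₁ hE
    fun u hu ν _ hlim => hident D E hE u hu ν hlim

/-- **CDHKS Theorem 1 (corrected transcription, leftmost interface) from `fkIsing_rsw` and F2**:
the named-fact frontier below `convergesInLawToSLE_three_isingInterface_zd` along this line is
`fkIsing_rsw` (`FKIsingRSW.lean`) and `isSLELaw_three_of_subseqLimit_spinInterface`
(`InterfaceSLEProofs.lean`). PROVED. [cite: CDHKSCRAS2014, Thm. 1 and §§2–3] -/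
theorem convergesInLawToSLE_three_isingInterface_zd_of_fkIsing_rsw (h₁ : fkIsing_rsw)
    (h₂ : isSLELaw_three_of_subseqLimit_spinInterface) :
    convergesInLawToSLE_three_isingInterface_zd :=
  fun _D _E hE => convergesInLawToSLE_leftmostInterface_of_fkIsing_rsw h₁ h₂ hE

end Literature.Probability.LatticeModels

end
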